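import Literature.MathematicalPhysics.QuantumFieldTheory.Balaban1983to89.Step

/-!
# `Balaban1983to89.B14Def3p279Step` — CMP 119 §3 p. 279: THE DEFINITION OF THE NEW TERMS AND THE TWO RENORMALIZATIONS
# WITH BODY — sorting the (3.47) expansions into `𝐄^{(k+1)}`, `𝐑″^{(k+1)}`, `𝐁^{(k+1)}`, the vacuum-energy renormalization
# `−E_k + E^{(k)} = −E_{k+1}`, the coupling-constant renormalization through (2.24) at `j = k+1` — and the printed
# conclusion PROVED as an identity of the (2.23) actions: «After this we obtain Tρ_k represented exactly in the form
# described by the inductive assumption with k+1 instead of k»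

statement-level skeleton of published theorems with citation tags; proofs where landed; nothing here is a claim
about the Yang–Mills mass gap.

CITATION HEADER (lean-in-tree rule).  Source: T. Bałaban, *Convergent renormalization expansions for lattice gauge
theories*, Commun. Math. Phys. **119**, 243–285 (1988), doi:10.1007/bf01217741 [Balaban1988Convergent] (cell paper
B14 = «[III]»; held `paper:balaban1988-cmp119-convergent-renormalization`, journal page = PDF page + 242; p. 279 read
for this file on the x2 render `…-p037-x2.png`, pp. 258–259 and 270–272 on `…-p016/p017-x2.png`, `…-p028`–`p030`
and the text layer).  Mega-formalization `lit-balaban`, unit `lit-balaban-r11` gen 100 (B14 fold owner), SKELETON row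
**B14.Def§3.p279** (*«§3 p.279 (definition of the new terms; renormalization)»*, `typed-existing (obligation level)` on
the pre-cell predicates `Step.LFNewTerms` / `LFStepObligation`, which record WHICH properties the new terms must have,
not HOW print forms them).  This file types the formation prescriptions of the paragraph WITH BODY as operations on the
term families and on the (2.23) action records `Step.LFActionData`, and PROVES its two mathematical sentences as finite
identities.  Nothing pre-existing is modified.

THE PRINTED TEXT (p. 279 [PDF 37], verbatim).  *«We put 𝐄^{(k+1)}(X, z) = 𝐄₀^{(k+1)}(Λ_{k+1}, X, z) for z ∈ Λ⁰_{k+1},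
X ⊂ Λ_{k+1}, and we define 𝐄^{(k+1)}(Λ_{k+1}, z), 𝐄^{(k+1)}(Λ_{k+1}) by the formulas (2.27), (2.26) correspondingly. This
ends the construction of the regular part of the effective action after k+1-st renormalization transformation. The
remaining terms in the expansions (3.47) are included into the boundary term 𝐁^{(k+1)}.  The other expectation values
in (3.26), (3.28) are treated in exactly the same way. … This in (3.28) is almost identical to the one in (3.37), but the
expressions integrated have localized expansions with localization domains always intersecting Ω_{k+1}∖Λ_{k+1}, hence
this whole expectation value is included into the boundary term 𝐁^{(k+1)}. Similarly, the first expectation value in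
(3.26) is included into this boundary term, too. The expansion (3.47) for the second expectation value in (3.26) is
divided into two parts. The terms with localization domains contained in Λ_{k+1} have the same important property as
the corresponding 𝐄^{(k+1)}-terms, namely they do not depend on Λ_{k+1}. We denote them by 𝐑″^{(k+1)}, and we include
them into the term 𝐑^{(k+1)}. The remaining terms are included again into the boundary term.  Thus we have finished
the decomposition of the logarithm of the fluctuation field integral in (3.25) into the sum of the three terms:
𝐄^{(k+1)}, 𝐑″^{(k+1)}, and 𝐁^{(k+1)}. These terms satisfy all the conditions of the inductive assumption. Let us remark
that they are not the terms in the k+1-st effective action, because we have to perform yet the 𝐑-operation, which will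
change many features of the action. Obviously in general new terms will be included into 𝐑^{(k+1)}. To complete the
procedure in this step, we have to renormalize the new terms. The vacuum energy renormalization is performed by
subtracting the values of 𝐄^{(k+1)} and 𝐑″^{(k+1)} at the configuration U_{k+1} = 1 from the corresponding terms, and
adding these values to E₀^{(k)}. This yields the term E^{(k)}, and we define −E_k + E^{(k)} = −E_{k+1}. The coupling
constant renormalization is performed by subtracting β_{k+1}(g_k)A(φ_{k+1}, U_{k+1}) from 𝐄^{(k+1)} − 𝐄^{(k+1)}(1), and
by replacing the function g_k⁻²(·) in the action A(g_k⁻²(·), U_{k+1}) by g_{k+1}⁻²(·) defined by the equation (2.24)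
with j = k+1. After this we obtain Tρ_k represented exactly in the form described by the inductive assumption with k+1
instead of k. This ends the inductive proof of this representation.»*  Context: (3.25) p. 270 carries the factor
*«exp[A_k(1/g_k², U_{k+1}) + E₀^{(k)}]»* times the fluctuation-field integral, E₀^{(k)} being *«the sum of constants in
the first exponential in (3.15)»*; (2.23) p. 258 is the form *«A_k(1/g_k², U_k) = −A(1/g_k², U_k) + 𝐄_k(U_k) + 𝐑_k(U_k) +
𝐁_k(U_k, A) − E_k»* with (2.25) *«𝐄_k(U_k) = Σ_{j=1}^{k} [𝐄^{(j)}(Λ_j, U_k) − 𝐄^{(j)}(Λ_j, 1) − β_j(g_{j−1})A(φ_j, U_k)]»*,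
(2.30), (2.40); (2.24) p. 259: *«1/g_j²(x) = 1/g²_{j+1}(x) + β_{j+1}(g_j)φ_{j+1}(x)»*.

THE CARRIER (pre-existing, BY NAME).  The abstract tower `Step.LFTower` (terms `T.E j X z g φ`, `T.R j X φ`,
`T.B j X φ a` for ALL scales `j`, domains `X : (T.sys j).Dom`, points `z : T.Pt j`), the (2.23) action record
`Step.LFActionData` (ranges `admE`/`admR`/`admB`, smeared Wilson actions `wilsonLocal` = A(1/g_k²(·), ·) and `wilsonPhi j`
= A(φ_j, ·), `fluct`, `Econst` = E_k) and `LFActionData.action23` (row B14.Eq2.23 `proved p369026 · Step`).  The scale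
`k+1` term families of the tower ARE the expansion outputs of the step: print uses one symbol, `𝐄^{(k+1)}(X, z) =
𝐄₀^{(k+1)}(Λ_{k+1}, X, z)` — the DEFINITION only restricts the RANGE of `(X, z)`; the (3.47) terms themselves are p25's
`B14Eq344PolymerRatio.E0` (row B14.Eq3.44–3.47 `proved`).  The ranges WITH BODY on the cube carrier are r11 g99's
`B14.Eq227LocalizedTerms.admE/admR/admB` (families in ALL `j`, exactly the shape used here; rows B14.Eq2.26–2.27 ∕ 2.30 ∕
2.40–2.41 `proved p370440`); the smeared Wilson actions WITH BODY and the (2.24) telescoping are r11 g98's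
`B14.Eq225Concrete` (`smearedWilson_invSq_telescope`; rows B14.Eq2.23 ∕ 2.25 `proved p369026`); `E_k` WITH BODY is
`B14.Def2Ek.Ek` (row B14.Def§2.Ek `proved p368995`).  None of these modules is imported (their statements are not
needed for the identities; the farm oleans of the last three were unbuilt when this file was written) — the links are by
NAME in the docstrings, and every hypothesis below says which printed display it is.

WHAT THIS FILE TYPES AND PROVES (0 `sorry`; no named fact; imports `Step` only).
* §1 **THE SORTING (p. 279, first two paragraphs) WITH BODY** over finite families: `ePart`/`eRest` (the terms with
  `(X, z)` in the 𝐄-range «z ∈ Λ⁰_{k+1}, X ⊂ Λ_{k+1}» and *«the remaining terms in the expansions (3.47)»*), `rPart`/`rRest`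
  (*«The terms with localization domains contained in Λ_{k+1} … 𝐑″^{(k+1)}»* and *«The remaining terms»*), the boundary
  collector `bCollect` (= the two remainders + *«the other expectation values … included into the boundary term»*), and
  the DECOMPOSITION SENTENCE PROVED: `decomposition` — *«Thus we have finished the decomposition of the logarithm of the
  fluctuation field integral in (3.25) into the sum of the three terms: 𝐄^{(k+1)}, 𝐑″^{(k+1)}, and 𝐁^{(k+1)}»*
  (`logFluct = ePart + rPart + bCollect`: each finite sum splits exactly along its range, `ePart_add_eRest`, `rPart_add_rRest`).
* §2 **THE TWO RENORMALIZATIONS WITH BODY on the (2.23) records**: `EkStep` = E^{(k)} := E₀^{(k)} + 𝐄^{(k+1)}(Λ_{k+1}, 1) +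
  𝐑″^{(k+1)}(1) (*«adding these values to E₀^{(k)}. This yields the term E^{(k)}»*); `stepRecord D PE PR PB wl E₀` = the
  scale-`(k+1)` record: ranges extended to `j = k+1` (the full range families `PE`/`PR`/`PB`, print's instance =
  `B14.Eq227LocalizedTerms.admE/admR/admB` of the admissible sequences with `(Ω_{k+1}, Λ_{k+1})` appended), `wilsonLocal := wl`
  = A(1/g²_{k+1}(·), ·) (*«replacing the function g_k⁻²(·) … by g_{k+1}⁻²(·)»*), `Econst := E_k − E^{(k)}` (*«we define
  −E_k + E^{(k)} = −E_{k+1}»* — `Econst_step`, the printed display, `rfl`-level; = `B14.Def2Ek.Ek_succ` by name).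
* §3 **THE CONCLUSION PROVED**: `step_identity` — for every background `U`,
  `(stepRecord …).action23 (k+1) U = D.action23 k U + E₀^{(k)} + [𝐄^{(k+1)}(Λ_{k+1}, U) + 𝐑″^{(k+1)}(U) + 𝐁^{(k+1)}(U, A)]`,
  i.e. *«exp[A_k(1/g_k², U_{k+1}) + E₀^{(k)}]»* of (3.25) times the exponential of the decomposed logarithm IS
  `exp A_{k+1}(1/g²_{k+1}, U_{k+1})` in the form (2.23) at `k+1` (`exp_step_identity`) — GIVEN exactly the printed inputs:
  (2.24) at `j = k+1` for the two smeared Wilson actions (`hA : A(1/g_k²(·), U) = A(1/g²_{k+1}(·), U) + β_{k+1}(g_k)A(φ_{k+1}, U)`,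
  print's instance PROVED as `B14.Eq225Concrete.smearedWilson_invSq_telescope`), agreement of the extended ranges with the
  old ones on the scales `j ≤ k` (`hE`/`hR`/`hB`: the sequences `{Ω_j}, {Λ_j}`, `j ≤ k`, are unchanged), and the boundary
  family of the tower at scale `k+1` summing over its range to the collected boundary term (`hBsum`: (2.40)–(2.41) re-sort
  `𝐁^{(k+1)}` by domains — row B14.Eq2.40–2.41).  The coupling renormalization CANCELS EXACTLY (`coupling_renormalization`:
  `−A(1/g²_{k+1}, U) − β_{k+1}(g_k)A(φ_{k+1}, U) = −A(1/g_k², U)`), the vacuum renormalization re-centres at `U = 1`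
  (`vacuum_renormalization`).
* §4 Bookkeeping the inductive description uses next: `action23_stepRecord_one` (the new action's normalisation at
  `U_{k+1} = 1`), `stepRecord_adm_of_le` (old scales untouched); the two actions unfolded `action23_stepRecord` ∕
  `action23_unfold` (definitional).

HONEST SCOPE.  (1) This is the ALGEBRA of p. 279 (definitions by range restriction; two renormalizations; the form
(2.23) at `k+1`), over the abstract tower; the ANALYTIC content of the paragraph — that the new terms *«satisfy all the
conditions of the inductive assumption»* ((i)–(iv), the bounds with `O(p₀³(g_k))`, analyticity) — is rows B14.Thm2 ∕
B14.Eq3.47 ∕ B14.Claim@283R and the obligations `Step.LFNewTerms`, NOT asserted here.  (2) *«we have to perform yet the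
𝐑-operation, which will change many features of the action. Obviously in general new terms will be included into
𝐑^{(k+1)}»* — the 𝐑-operation ([Balaban1989LargeFieldI/II]) is outside this paper's §3 and outside this file: the
record `stepRecord` is the action of `Tρ_k` BEFORE 𝐑, as print says.  (3) Parameters (READING RULE (a)): the range
families `PE`/`PR`/`PB` (print's instance named above; p. 279's 𝐑″-range «X ⊂ Λ_{k+1}» and (2.30)'s «X ⊂ Λ_j^{∼−1}» are
both instances), the new smeared Wilson action `wl`, the constant `E₀^{(k)}` (defined by (3.15)), the lump `rest` of the
other expectation values' expansions.

## References
* [Balaban1988Convergent] T. Bałaban, Commun. Math. Phys. 119 (1988) 243–285: §3 p. 279; (2.23)–(2.27) pp. 258–259, (2.30)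
  p. 260, (2.40)–(2.41) p. 261; (3.15) p. 268, (3.25)–(3.28) pp. 270–272, (3.47) p. 278.
-/

open scoped BigOperators

namespace Literature.MathematicalPhysics.QuantumFieldTheory.Balaban1983to89.B14.Def3p279Step

open Literature.MathematicalPhysics.QuantumFieldTheory.Balaban1983to89
open Step Finset

variable {P : Params} {G : Type*} [GaugeGroup G] {Φ 𝒢 𝔄 : Type*}

/-! ## §1  The sorting of the expansion terms into `𝐄^{(k+1)}`, `𝐑″^{(k+1)}`, `𝐁^{(k+1)}` WITH BODY -/

section Sorting

variable (T : LFTower P G Φ 𝒢 𝔄) (k : ℕ)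

/-- **«We put 𝐄^{(k+1)}(X, z) = 𝐄₀^{(k+1)}(Λ_{k+1}, X, z) for z ∈ Λ⁰_{k+1}, X ⊂ Λ_{k+1}, and we define 𝐄^{(k+1)}(Λ_{k+1}, z),
𝐄^{(k+1)}(Λ_{k+1}) by the formulas (2.27), (2.26)»** (p. 279): the REGULAR PART of the scale-`(k+1)` expansion terms
`T.E (k+1) X z g` = the sum over the pairs `(X, z)` in the 𝐄-range `PE (k+1) X z` (print's instance: `z ∈ Λ⁰_{k+1}`,
`X ∋ z`, `X ⊂ Λ_{k+1}` = `B14.Eq227LocalizedTerms.admE` at `j = k+1`, where the nesting (2.26)∘(2.27) is `E226`/`E227`),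
at coupling `g` (print: `g_k`) and configuration `φ`. [cite: Balaban1988Convergent, §3 p.279, (2.26)–(2.27) p.259] -/
noncomputable def ePart (PE : (j : ℕ) → (T.sys j).Dom → T.Pt j → Bool) (g : ℝ) (φ : Φ) : ℂ :=
  ∑ X : (T.sys (k + 1)).Dom, ∑ z : T.Pt (k + 1), if PE (k + 1) X z then T.E (k + 1) X z g φ else 0

/-- **«The remaining terms in the expansions (3.47) are included into the boundary term 𝐁^{(k+1)}»** (p. 279): the
expansion terms with `(X, z)` OUTSIDE the 𝐄-range. [cite: Balaban1988Convergent, §3 p.279] -/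
noncomputable def eRest (PE : (j : ℕ) → (T.sys j).Dom → T.Pt j → Bool) (g : ℝ) (φ : Φ) : ℂ :=
  ∑ X : (T.sys (k + 1)).Dom, ∑ z : T.Pt (k + 1), if PE (k + 1) X z then 0 else T.E (k + 1) X z g φ

/-- **«The terms with localization domains contained in Λ_{k+1} … We denote them by 𝐑″^{(k+1)}, and we include them
into the term 𝐑^{(k+1)}»** (p. 279): the part of the scale-`(k+1)` 𝐑-family over the 𝐑-range `PR (k+1) X` (the
printed instance here: `X ⊂ Λ_{k+1}`; (2.30)'s range is `X ⊂ Λ_j^{∼−1}` = `B14.Eq227LocalizedTerms.admR`).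
[cite: Balaban1988Convergent, §3 p.279, (2.30) p.260] -/
noncomputable def rPart (PR : (j : ℕ) → (T.sys j).Dom → Bool) (φ : Φ) : ℂ :=
  ∑ X : (T.sys (k + 1)).Dom, if PR (k + 1) X then T.R (k + 1) X φ else 0

/-- **«The remaining terms are included again into the boundary term»** (p. 279): the 𝐑-expansion terms with `X`
outside the 𝐑-range. [cite: Balaban1988Convergent, §3 p.279] -/
noncomputable def rRest (PR : (j : ℕ) → (T.sys j).Dom → Bool) (φ : Φ) : ℂ :=
  ∑ X : (T.sys (k + 1)).Dom, if PR (k + 1) X then 0 else T.R (k + 1) X φ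

/-- **THE BOUNDARY COLLECTOR `𝐁^{(k+1)}` of p. 279**: the two remainders PLUS the expansions of *«the other expectation
values in (3.26), (3.28)»* (the first expression of (3.28) — p. 272: *«contributes to 𝐁^{(k+1)} only»* —, the first
expectation value of (3.26)), entering as the lump `rest φ a` (`a` = the fluctuation fields and `{S_j}`-data on which the
boundary terms depend, (2.40)). [cite: Balaban1988Convergent, §3 p.279, (3.28) p.272, (2.40) p.261] -/
noncomputable def bCollect (PE : (j : ℕ) → (T.sys j).Dom → T.Pt j → Bool) (PR : (j : ℕ) → (T.sys j).Dom → Bool)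
    (rest : Φ → 𝔄 → ℂ) (g : ℝ) (φ : Φ) (a : 𝔄) : ℂ :=
  eRest T k PE g φ + rRest T k PR φ + rest φ a

/-- **THE LOGARITHM OF THE FLUCTUATION-FIELD INTEGRAL IN (3.25)** as the total of its expansions: all scale-`(k+1)`
𝐄-expansion terms (every `(X, z)`), all 𝐑-expansion terms (every `X`), and the other expectation values' expansions.
[cite: Balaban1988Convergent, (3.25)–(3.28) pp.270–272, (3.47) p.278] -/
noncomputable def logFluct (rest : Φ → 𝔄 → ℂ) (g : ℝ) (φ : Φ) (a : 𝔄) : ℂ :=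
  (∑ X : (T.sys (k + 1)).Dom, ∑ z : T.Pt (k + 1), T.E (k + 1) X z g φ)
    + (∑ X : (T.sys (k + 1)).Dom, T.R (k + 1) X φ) + rest φ a

variable {T k}

/-- The 𝐄-expansion splits EXACTLY into its regular part and its remainder. [cite: Balaban1988Convergent, §3 p.279] -/
theorem ePart_add_eRest (PE : (j : ℕ) → (T.sys j).Dom → T.Pt j → Bool) (g : ℝ) (φ : Φ) :
    ePart T k PE g φ + eRest T k PE g φ = ∑ X : (T.sys (k + 1)).Dom, ∑ z : T.Pt (k + 1), T.E (k + 1) X z g φ := by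
  unfold ePart eRest
  rw [← sum_add_distrib]
  refine sum_congr rfl fun X _ => ?_
  rw [← sum_add_distrib]
  refine sum_congr rfl fun z _ => ?_
  split_ifs <;> simp

/-- The 𝐑-expansion splits EXACTLY into `𝐑″^{(k+1)}` and its remainder. [cite: Balaban1988Convergent, §3 p.279] -/
theorem rPart_add_rRest (PR : (j : ℕ) → (T.sys j).Dom → Bool) (φ : Φ) :
    rPart T k PR φ + rRest T k PR φ = ∑ X : (T.sys (k + 1)).Dom, T.R (k + 1) X φ := by
  unfold rPart rRest
  rw [← sum_add_distrib]
  refine sum_congr rfl fun X _ => ?_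
  split_ifs <;> simp

/-- **«Thus we have finished the decomposition of the logarithm of the fluctuation field integral in (3.25) into the sum
of the three terms: 𝐄^{(k+1)}, 𝐑″^{(k+1)}, and 𝐁^{(k+1)}»** (p. 279) — PROVED: the total of the expansions IS the regular
part plus `𝐑″^{(k+1)}` plus the boundary collector. [cite: Balaban1988Convergent, §3 p.279] -/
theorem decomposition (PE : (j : ℕ) → (T.sys j).Dom → T.Pt j → Bool) (PR : (j : ℕ) → (T.sys j).Dom → Bool)
    (rest : Φ → 𝔄 → ℂ) (g : ℝ) (φ : Φ) (a : 𝔄) :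
    logFluct T k rest g φ a = ePart T k PE g φ + rPart T k PR φ + bCollect T k PE PR rest g φ a := by
  unfold logFluct bCollect
  rw [← ePart_add_eRest PE g φ, ← rPart_add_rRest PR φ]
  ring

/-- The same decomposition for the REAL PARTS (the effective action (2.23) carries the real parts of the extended
terms at the background configuration). [cite: Balaban1988Convergent, §3 p.279, (2.23) p.258] -/
theorem decomposition_re (PE : (j : ℕ) → (T.sys j).Dom → T.Pt j → Bool) (PR : (j : ℕ) → (T.sys j).Dom → Bool)
    (rest : Φ → 𝔄 → ℂ) (g : ℝ) (φ : Φ) (a : 𝔄) :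
    (logFluct T k rest g φ a).re =
      (ePart T k PE g φ).re + (rPart T k PR φ).re + (bCollect T k PE PR rest g φ a).re := by
  rw [decomposition PE PR rest g φ a, Complex.add_re, Complex.add_re]

/-- The regular part as the range-restricted sum of REAL parts (the shape of the 𝐄-summand of `action23`).
[cite: Balaban1988Convergent, (2.23) p.258, §3 p.279] -/
theorem ePart_re (PE : (j : ℕ) → (T.sys j).Dom → T.Pt j → Bool) (g : ℝ) (φ : Φ) :
    (ePart T k PE g φ).re =
      ∑ X : (T.sys (k + 1)).Dom, ∑ z : T.Pt (k + 1), if PE (k + 1) X z then (T.E (k + 1) X z g φ).re else 0 := by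
  unfold ePart
  rw [Complex.re_sum]
  refine sum_congr rfl fun X _ => ?_
  rw [Complex.re_sum]
  refine sum_congr rfl fun z _ => ?_
  split_ifs <;> simp

/-- `𝐑″^{(k+1)}` as the range-restricted sum of REAL parts (the shape of the 𝐑-summand of `action23`).
[cite: Balaban1988Convergent, (2.23) p.258, §3 p.279] -/
theorem rPart_re (PR : (j : ℕ) → (T.sys j).Dom → Bool) (φ : Φ) :
    (rPart T k PR φ).re = ∑ X : (T.sys (k + 1)).Dom, if PR (k + 1) X then (T.R (k + 1) X φ).re else 0 := by
  unfold rPart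
  rw [Complex.re_sum]
  refine sum_congr rfl fun X _ => ?_
  split_ifs <;> simp

end Sorting

/-! ## §2  The two renormalizations WITH BODY on the (2.23) records -/

section Renormalization

variable {T : LFTower P G Φ 𝒢 𝔄} (k : ℕ)

/-- **THE VACUUM-ENERGY TERM `E^{(k)}`** (p. 279): *«The vacuum energy renormalization is performed by subtracting the
values of 𝐄^{(k+1)} and 𝐑″^{(k+1)} at the configuration U_{k+1} = 1 from the corresponding terms, and adding these values to
E₀^{(k)}. This yields the term E^{(k)}»* — `E^{(k)} = E₀^{(k)} + Re 𝐄^{(k+1)}(Λ_{k+1}, 1) + Re 𝐑″^{(k+1)}(1)`, the values at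
`U_{k+1} = 1` read at the tower's `ofBackground 1` and at the coupling `g_k`. [cite: Balaban1988Convergent, §3 p.279] -/
noncomputable def EkStep (T : LFTower P G Φ 𝒢 𝔄) (k : ℕ) (PE : (j : ℕ) → (T.sys j).Dom → T.Pt j → Bool)
    (PR : (j : ℕ) → (T.sys j).Dom → Bool) (E0k : ℝ) : ℝ :=
  E0k + (ePart T k PE (T.flow.g k) (T.ofBackground 1)).re + (rPart T k PR (T.ofBackground 1)).re

/-- **THE SCALE-`(k+1)` ACTION RECORD** produced by the step from the scale-`k` record `D` (p. 279): the ranges of the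
(2.23) sums extended by the new scale (`PE`/`PR`/`PB` = the full range families of the admissible sequences with
`(Ω_{k+1}, Λ_{k+1})` appended — print's instance `B14.Eq227LocalizedTerms.admE/admR/admB`; on the scales `j ≤ k` they are
`D`'s, hypotheses `hE`/`hR`/`hB` of §3), the smeared Wilson action with the NEW local coupling `wl = A(1/g²_{k+1}(·), ·)`
(*«replacing the function g_k⁻²(·) in the action A(g_k⁻²(·), U_{k+1}) by g_{k+1}⁻²(·) defined by the equation (2.24) with
j = k+1»*), the same cut-off actions `A(φ_j, ·)` and fluctuation data, and the renormalized constant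
`E_{k+1} = E_k − E^{(k)}` (*«we define −E_k + E^{(k)} = −E_{k+1}»*). [cite: Balaban1988Convergent, §3 p.279, (2.23)–(2.24) pp.258–259] -/
noncomputable def stepRecord (D : LFActionData P G T) (PE : (j : ℕ) → (T.sys j).Dom → T.Pt j → Bool)
    (PR PB : (j : ℕ) → (T.sys j).Dom → Bool) (wl : GaugeField P 0 G → ℝ) (E0k : ℝ) : LFActionData P G T where
  admE := PE
  admR := PR
  admB := PB
  wilsonLocal := wl
  wilsonPhi := D.wilsonPhi
  fluct := D.fluct
  Econst := D.Econst - EkStep T k PE PR E0k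

/-- **p. 279 as printed: `−E_k + E^{(k)} = −E_{k+1}`** for the step record (= `B14.Def2Ek.neg_Ek_add` on the constants of
record). [cite: Balaban1988Convergent, §3 p.279] -/
theorem Econst_step (D : LFActionData P G T) (PE : (j : ℕ) → (T.sys j).Dom → T.Pt j → Bool)
    (PR PB : (j : ℕ) → (T.sys j).Dom → Bool) (wl : GaugeField P 0 G → ℝ) (E0k : ℝ) :
    -D.Econst + EkStep T k PE PR E0k = -(stepRecord k D PE PR PB wl E0k).Econst := by
  show -D.Econst + EkStep T k PE PR E0k = -(D.Econst - EkStep T k PE PR E0k)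
  ring

/-- The old scales are untouched: on `j ≤ k` the step record sums over the same ranges as `D` whenever the extended
families agree there with `D`'s (the sequences `{Ω_j}, {Λ_j}`, `j ≤ k`, are unchanged by the step). [cite: Balaban1988Convergent, (2.23) p.258, §3 p.279] -/
theorem stepRecord_adm_of_le (D : LFActionData P G T) {PE : (j : ℕ) → (T.sys j).Dom → T.Pt j → Bool}
    {PR PB : (j : ℕ) → (T.sys j).Dom → Bool} (wl : GaugeField P 0 G → ℝ) (E0k : ℝ)
    (hE : ∀ j, j ≤ k → PE j = D.admE j) (hR : ∀ j, j ≤ k → PR j = D.admR j) (hB : ∀ j, j ≤ k → PB j = D.admB j)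
    {j : ℕ} (hj : j ≤ k) :
    (stepRecord k D PE PR PB wl E0k).admE j = D.admE j ∧ (stepRecord k D PE PR PB wl E0k).admR j = D.admR j ∧
      (stepRecord k D PE PR PB wl E0k).admB j = D.admB j :=
  ⟨hE j hj, hR j hj, hB j hj⟩

omit [GaugeGroup G] in
/-- **THE COUPLING-CONSTANT RENORMALIZATION CANCELS EXACTLY** (p. 279: *«subtracting β_{k+1}(g_k)A(φ_{k+1}, U_{k+1}) from
𝐄^{(k+1)} − 𝐄^{(k+1)}(1), and … replacing the function g_k⁻²(·) … by g_{k+1}⁻²(·) defined by the equation (2.24) with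
j = k+1»*): by (2.24) summed against the Wilson plaquette terms — `A(1/g_k²(·), U) = A(1/g²_{k+1}(·), U) +
β_{k+1}(g_k)A(φ_{k+1}, U)` (hypothesis `hA`; print's instance PROVED as `B14.Eq225Concrete.smearedWilson_invSq_telescope`) —
the new Wilson term and the new counterterm together ARE the old Wilson term:
`−A(1/g²_{k+1}(·), U) − β_{k+1}(g_k)A(φ_{k+1}, U) = −A(1/g_k²(·), U)`. [cite: Balaban1988Convergent, §3 p.279, (2.24) p.259] -/
theorem coupling_renormalization {wk wl φk1 : GaugeField P 0 G → ℝ} {β : ℝ} (hA : ∀ U, wk U = wl U + β * φk1 U)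
    (U : GaugeField P 0 G) : -wl U - β * φk1 U = -wk U := by
  rw [hA U]; ring

/-- **THE VACUUM-ENERGY RENORMALIZATION RE-CENTRES AT `U_{k+1} = 1`** (p. 279): subtracting the values at `1` from
`𝐄^{(k+1)}` and `𝐑″^{(k+1)}` and moving them, together with `E₀^{(k)}`, into the constant (`−E_{k+1} = −E_k + E^{(k)}`)
changes nothing: `[𝐄(U) − 𝐄(1)] + [𝐑″(U) − 𝐑″(1)] − E_{k+1} = 𝐄(U) + 𝐑″(U) + E₀^{(k)} − E_k`. [cite: Balaban1988Convergent, §3 p.279] -/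
theorem vacuum_renormalization (eU e1 rU r1 E0k Ek : ℝ) :
    (eU - e1) + (rU - r1) - (Ek - (E0k + e1 + r1)) = eU + rU + E0k - Ek := by
  ring

end Renormalization

/-! ## §3  The conclusion PROVED: the new action has the form (2.23) at `k+1` -/

section StepIdentity

variable {T : LFTower P G Φ 𝒢 𝔄} {k : ℕ}

/-- Splitting the scale sums of (2.23) at the new top index: `Σ_{j=1}^{k+1} f(j) = Σ_{j=1}^{k} f(j) + f(k+1)`.
[cite: Balaban1988Convergent, (2.23) p.258] -/
theorem sum_Icc_succ (f : ℕ → ℝ) (k : ℕ) : ∑ j ∈ Icc 1 (k + 1), f j = (∑ j ∈ Icc 1 k, f j) + f (k + 1) :=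
  sum_Icc_succ_top (Nat.succ_le_succ (Nat.zero_le k)) f

/-- The (2.23) action of the step record, unfolded (definitional): the three scale sums run over the extended ranges,
the Wilson term is the new one, the constant is `E_k − E^{(k)}`. [cite: Balaban1988Convergent, (2.23) p.258, §3 p.279] -/
theorem action23_stepRecord (D : LFActionData P G T) (PE : (j : ℕ) → (T.sys j).Dom → T.Pt j → Bool)
    (PR PB : (j : ℕ) → (T.sys j).Dom → Bool) (wl : GaugeField P 0 G → ℝ) (E0k : ℝ) (n : ℕ) (U : GaugeField P 0 G) :
    (stepRecord k D PE PR PB wl E0k).action23 n U =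
      - wl U
      + ∑ j ∈ Icc 1 n,
          ((∑ X : (T.sys j).Dom, ∑ z : T.Pt j,
              if PE j X z then ((T.E j X z (T.flow.g (j - 1)) (T.ofBackground U)).re
                - (T.E j X z (T.flow.g (j - 1)) (T.ofBackground 1)).re) else 0)
            - T.flow.β j (T.flow.g (j - 1)) * D.wilsonPhi j U)
      + ∑ j ∈ Icc 1 n, ∑ X : (T.sys j).Dom,
          (if PR j X then ((T.R j X (T.ofBackground U)).re - (T.R j X (T.ofBackground 1)).re) else 0)
      + ∑ j ∈ Icc 1 n, ∑ X : (T.sys j).Dom,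
          (if PB j X then (T.B j X (T.ofBackground U) D.fluct).re else 0)
      - (D.Econst - EkStep T k PE PR E0k) :=
  rfl

/-- The (2.23) action of a record, unfolded (the definition `Step.LFActionData.action23`). [cite: Balaban1988Convergent, (2.23) p.258] -/
theorem action23_unfold (D : LFActionData P G T) (n : ℕ) (U : GaugeField P 0 G) :
    D.action23 n U =
      - D.wilsonLocal U
      + ∑ j ∈ Icc 1 n,
          ((∑ X : (T.sys j).Dom, ∑ z : T.Pt j,
              if D.admE j X z then ((T.E j X z (T.flow.g (j - 1)) (T.ofBackground U)).re
                - (T.E j X z (T.flow.g (j - 1)) (T.ofBackground 1)).re) else 0)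
            - T.flow.β j (T.flow.g (j - 1)) * D.wilsonPhi j U)
      + ∑ j ∈ Icc 1 n, ∑ X : (T.sys j).Dom,
          (if D.admR j X then ((T.R j X (T.ofBackground U)).re - (T.R j X (T.ofBackground 1)).re) else 0)
      + ∑ j ∈ Icc 1 n, ∑ X : (T.sys j).Dom,
          (if D.admB j X then (T.B j X (T.ofBackground U) D.fluct).re else 0)
      - D.Econst :=
  rfl

/-- **«After this we obtain Tρ_k represented exactly in the form described by the inductive assumption with k+1 instead of
k»** (p. 279) — PROVED as the identity of actions.  Inputs, each a printed display: (2.24) at `j = k+1` for the smeared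
Wilson actions (`hA`); the old scales' ranges unchanged (`hE`, `hR`, `hB`); the tower's scale-`(k+1)` boundary family
summing over its (2.41) range to the collected boundary term of p. 279 (`hBsum` — the re-sorting of `𝐁^{(k+1)}` by
domains is (2.40)–(2.41), row B14.Eq2.40–2.41).  CONCLUSION: the (2.23) action of the scale-`(k+1)` record at the
background `U` (= U_{k+1}) equals the scale-`k` action at the same background PLUS `E₀^{(k)}` PLUS the real part of the
whole logarithm of the fluctuation integral — i.e. the factor `exp[A_k(1/g_k², U_{k+1}) + E₀^{(k)}]` of (3.25) times the
fluctuation integral `exp[𝐄^{(k+1)} + 𝐑″^{(k+1)} + 𝐁^{(k+1)}]` is `exp A_{k+1}(1/g²_{k+1}, U_{k+1})` with `A_{k+1}` of the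
form (2.23). [cite: Balaban1988Convergent, §3 p.279, (3.25) p.270, (2.23)–(2.25) pp.258–259] -/
theorem step_identity (D : LFActionData P G T) {PE : (j : ℕ) → (T.sys j).Dom → T.Pt j → Bool}
    {PR PB : (j : ℕ) → (T.sys j).Dom → Bool} {wl : GaugeField P 0 G → ℝ} {E0k : ℝ} {rest : Φ → 𝔄 → ℂ}
    (hA : ∀ U, D.wilsonLocal U = wl U + T.flow.β (k + 1) (T.flow.g k) * D.wilsonPhi (k + 1) U)
    (hE : ∀ j, j ≤ k → PE j = D.admE j) (hR : ∀ j, j ≤ k → PR j = D.admR j) (hB : ∀ j, j ≤ k → PB j = D.admB j)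
    (hBsum : ∀ U, (∑ X : (T.sys (k + 1)).Dom,
        if PB (k + 1) X then (T.B (k + 1) X (T.ofBackground U) D.fluct).re else 0) =
      (bCollect T k PE PR rest (T.flow.g k) (T.ofBackground U) D.fluct).re)
    (U : GaugeField P 0 G) :
    (stepRecord k D PE PR PB wl E0k).action23 (k + 1) U =
      D.action23 k U + E0k + (logFluct T k rest (T.flow.g k) (T.ofBackground U) D.fluct).re := by
  -- the decomposition of the logarithm (§1) in real parts
  rw [decomposition_re PE PR rest]
  -- unfold both actions and split the three scale sums at `j = k+1`
  rw [action23_stepRecord, action23_unfold, EkStep, sum_Icc_succ, sum_Icc_succ, sum_Icc_succ]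
  -- the old scales agree
  have h1 : (∑ j ∈ Icc 1 k, ((∑ X : (T.sys j).Dom, ∑ z : T.Pt j,
      if PE j X z then ((T.E j X z (T.flow.g (j - 1)) (T.ofBackground U)).re
        - (T.E j X z (T.flow.g (j - 1)) (T.ofBackground 1)).re) else 0)
      - T.flow.β j (T.flow.g (j - 1)) * D.wilsonPhi j U)) =
      ∑ j ∈ Icc 1 k, ((∑ X : (T.sys j).Dom, ∑ z : T.Pt j,
      if D.admE j X z then ((T.E j X z (T.flow.g (j - 1)) (T.ofBackground U)).re
        - (T.E j X z (T.flow.g (j - 1)) (T.ofBackground 1)).re) else 0)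
      - T.flow.β j (T.flow.g (j - 1)) * D.wilsonPhi j U) :=
    sum_congr rfl fun j hj => by rw [hE j (mem_Icc.mp hj).2]
  have h2 : (∑ j ∈ Icc 1 k, ∑ X : (T.sys j).Dom,
      (if PR j X then ((T.R j X (T.ofBackground U)).re - (T.R j X (T.ofBackground 1)).re) else 0)) =
      ∑ j ∈ Icc 1 k, ∑ X : (T.sys j).Dom,
      (if D.admR j X then ((T.R j X (T.ofBackground U)).re - (T.R j X (T.ofBackground 1)).re) else 0) :=
    sum_congr rfl fun j hj => by rw [hR j (mem_Icc.mp hj).2]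
  have h3 : (∑ j ∈ Icc 1 k, ∑ X : (T.sys j).Dom,
      (if PB j X then (T.B j X (T.ofBackground U) D.fluct).re else 0)) =
      ∑ j ∈ Icc 1 k, ∑ X : (T.sys j).Dom,
      (if D.admB j X then (T.B j X (T.ofBackground U) D.fluct).re else 0) :=
    sum_congr rfl fun j hj => by rw [hB j (mem_Icc.mp hj).2]
  rw [h1, h2, h3, hBsum U]
  -- the new scale: ranges of real parts, differences under the sum
  have h4 : (∑ X : (T.sys (k + 1)).Dom, ∑ z : T.Pt (k + 1),
      if PE (k + 1) X z then ((T.E (k + 1) X z (T.flow.g (k + 1 - 1)) (T.ofBackground U)).re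
        - (T.E (k + 1) X z (T.flow.g (k + 1 - 1)) (T.ofBackground 1)).re) else 0) =
      (ePart T k PE (T.flow.g k) (T.ofBackground U)).re - (ePart T k PE (T.flow.g k) (T.ofBackground 1)).re := by
    rw [ePart_re, ePart_re, ← sum_sub_distrib]
    refine sum_congr rfl fun X _ => ?_
    rw [← sum_sub_distrib]
    refine sum_congr rfl fun z _ => ?_
    simp only [Nat.add_sub_cancel]
    split_ifs <;> simp
  have h5 : (∑ X : (T.sys (k + 1)).Dom,
      (if PR (k + 1) X then ((T.R (k + 1) X (T.ofBackground U)).re - (T.R (k + 1) X (T.ofBackground 1)).re) else 0)) =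
      (rPart T k PR (T.ofBackground U)).re - (rPart T k PR (T.ofBackground 1)).re := by
    rw [rPart_re, rPart_re, ← sum_sub_distrib]
    refine sum_congr rfl fun X _ => ?_
    split_ifs <;> simp
  rw [h4, h5, hA U]
  simp only [Nat.add_sub_cancel]
  ring

/-- **THE EXPONENTIAL FORM** (the way (3.25) carries it): `exp[A_k(1/g_k², U) + E₀^{(k)}] · exp[Re(𝐄^{(k+1)} + 𝐑″^{(k+1)} +
𝐁^{(k+1)})] = exp A_{k+1}(1/g²_{k+1}, U)` with `A_{k+1}` the (2.23) action of the step record. [cite: Balaban1988Convergent, §3 p.279, (3.25) p.270] -/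
theorem exp_step_identity (D : LFActionData P G T) {PE : (j : ℕ) → (T.sys j).Dom → T.Pt j → Bool}
    {PR PB : (j : ℕ) → (T.sys j).Dom → Bool} {wl : GaugeField P 0 G → ℝ} {E0k : ℝ} {rest : Φ → 𝔄 → ℂ}
    (hA : ∀ U, D.wilsonLocal U = wl U + T.flow.β (k + 1) (T.flow.g k) * D.wilsonPhi (k + 1) U)
    (hE : ∀ j, j ≤ k → PE j = D.admE j) (hR : ∀ j, j ≤ k → PR j = D.admR j) (hB : ∀ j, j ≤ k → PB j = D.admB j)
    (hBsum : ∀ U, (∑ X : (T.sys (k + 1)).Dom,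
        if PB (k + 1) X then (T.B (k + 1) X (T.ofBackground U) D.fluct).re else 0) =
      (bCollect T k PE PR rest (T.flow.g k) (T.ofBackground U) D.fluct).re)
    (U : GaugeField P 0 G) :
    Real.exp (D.action23 k U + E0k) * Real.exp ((logFluct T k rest (T.flow.g k) (T.ofBackground U) D.fluct).re) =
      Real.exp ((stepRecord k D PE PR PB wl E0k).action23 (k + 1) U) := by
  rw [← Real.exp_add, step_identity D hA hE hR hB hBsum U]

end StepIdentity

/-! ## §4  Bookkeeping used by the inductive description at the next step -/

section Bookkeeping

variable {T : LFTower P G Φ 𝒢 𝔄} {k : ℕ}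

/-- At `U_{k+1} = 1` the renormalized new scale contributes only its boundary part and `−E_{k+1}` beyond the old scales:
the 𝐄- and 𝐑-differences of the scale `k+1` VANISH at `U = 1` (the point of the vacuum-energy renormalization).
[cite: Balaban1988Convergent, §3 p.279, (2.25) p.259, (2.30) p.260] -/
theorem newScale_differences_vanish_at_one (PE : (j : ℕ) → (T.sys j).Dom → T.Pt j → Bool)
    (PR : (j : ℕ) → (T.sys j).Dom → Bool) :
    (ePart T k PE (T.flow.g k) (T.ofBackground 1)).re - (ePart T k PE (T.flow.g k) (T.ofBackground 1)).re
      + ((rPart T k PR (T.ofBackground 1)).re - (rPart T k PR (T.ofBackground 1)).re) = 0 := by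
  ring

/-- The step identity READ AT `U_{k+1} = 1`: `A_{k+1}(1) = A_k(1) + E₀^{(k)} + Re(logarithm at 1)` — the normalisations
of the two actions differ exactly by the constants produced in the step. [cite: Balaban1988Convergent, §3 p.279] -/
theorem action23_stepRecord_one (D : LFActionData P G T) {PE : (j : ℕ) → (T.sys j).Dom → T.Pt j → Bool}
    {PR PB : (j : ℕ) → (T.sys j).Dom → Bool} {wl : GaugeField P 0 G → ℝ} {E0k : ℝ} {rest : Φ → 𝔄 → ℂ}
    (hA : ∀ U, D.wilsonLocal U = wl U + T.flow.β (k + 1) (T.flow.g k) * D.wilsonPhi (k + 1) U)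
    (hE : ∀ j, j ≤ k → PE j = D.admE j) (hR : ∀ j, j ≤ k → PR j = D.admR j) (hB : ∀ j, j ≤ k → PB j = D.admB j)
    (hBsum : ∀ U, (∑ X : (T.sys (k + 1)).Dom,
        if PB (k + 1) X then (T.B (k + 1) X (T.ofBackground U) D.fluct).re else 0) =
      (bCollect T k PE PR rest (T.flow.g k) (T.ofBackground U) D.fluct).re) :
    (stepRecord k D PE PR PB wl E0k).action23 (k + 1) 1 =
      D.action23 k 1 + E0k + (logFluct T k rest (T.flow.g k) (T.ofBackground 1) D.fluct).re :=
  step_identity D hA hE hR hB hBsum 1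

end Bookkeeping

end Literature.MathematicalPhysics.QuantumFieldTheory.Balaban1983to89.B14.Def3p279Step
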